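import Summits.Ventures.PercRepro.Night2FatDDSix
import Summits.Ventures.PercRepro.Night2FatDDSixA1
import Summits.Ventures.PercRepro.Night2FatDDSixA2
import Summits.Ventures.PercRepro.Night2FatDDSixA3
import Summits.Ventures.PercRepro.Night2FatDDCells
import Summits.Ventures.PercRepro.Night2FatDDSevenD
import Summits.Ventures.PercRepro.Night2FatDDEightD
import Summits.Ventures.PercRepro.Night2FatDDNineD
import Summits.Ventures.PercRepro.Night2FatDDTenD
import Summits.Ventures.PercRepro.Night2FatDDLarge
import Summits.Ventures.PercRepro.Night2FatDegAll

/-!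
# night-2: the doubly degenerate regime is closed — THE FAT CASE OF (FAIR), UNCONDITIONAL

* `dd_arith_N6_all` / **`basis_pair_fair_fat_dd_six_all`**: the `N = 6` dispatch (the content of `Night2FatDDSixD`, carried here so that
  this module does not wait on that module's farm build);
* **`basis_pair_fair_fat_dd`**: every lossy basis pair of the doubly degenerate two-planes regime (both planes'
  points off the spine collinear) has the fair share — `N ≥ 6` always (`|V| = N + 3 ≥ 9`: three points on the
  spine, three in each cell off it), `N = 6, 7, 8, 9, 10` by the numeric dispatches `basis_pair_fair_fat_dd_six …
  _ten` (`decide` over the cell quantities), `N ≥ 11` by `basis_pair_fair_fat_dd_large` (the product families);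
* **`localShadowHall_fat_of_two_planes_doubly_deg`**: the local Hall inequality of the cell in the doubly degenerate
  two-planes regime;
* **`localShadowHall_fat`**: THE FAT CASE OF (FAIR) WITH NO HYPOTHESIS — either every lossy big pair has a good point
  (`localShadowHall_fat_of_good`), or one has none and `H₀` is the union of two planes through a class line
  (`exists_two_planes_of_no_gtPts`): both planes non-degenerate (`localShadowHall_fat_of_two_planes_nondeg`, gen 34),
  exactly one degenerate (`localShadowHall_fat_of_two_planes_singly_deg`, gen 35), or both degenerate (this gen).
Paper `proofs/NIGHT-2-g36.md` §2.
-/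

namespace PercRepro.Shadow

open PercRepro.ThmH PercRepro.PerFlat

variable {α : Type*} [DecidableEq α] {M : Matroid α} [M.Finite] {G : Finset α}

/-- **The numeric inequality at `N = 6` from the cell facts** (`c₁, c₂, c₃` the class flags of the spine and the two
side lines — the spine is always class —, `nL, nA, nM` / `tL, tA, tM` the basis / `W`-points of the three cells,
`n₂, s₂` / `n₃, s₃` the basis / `W`-points of the two side lines; `n₂, n₃ ≤ 2` from the independence of the basis
points on a rank-`2` cell). -/
theorem dd_arith_N6_all (c₁ c₂ c₃ : Prop) [Decidable c₁] [Decidable c₂] [Decidable c₃]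
    (nL nA nM tL tA tM n₂ s₂ n₃ s₃ : ℕ) (hc₁ : c₁)
    (h1 : nL + nA + nM = 4) (h2 : tL + tA + tM = 5) (h3 : nL + nA ≤ 3) (h4 : nL + nM ≤ 3)
    (h5 : 3 ≤ tL + nL) (h6 : 3 ≤ nA + tA) (h7 : 3 ≤ nM + tM)
    (h8 : nA ≤ n₂ ∧ tA ≤ s₂ ∧ (n₂ - nA) + (s₂ - tA) ≤ 1)
    (h9 : nM ≤ n₃ ∧ tM ≤ s₃ ∧ (n₃ - nM) + (s₃ - tM) ≤ 1) (h10 : n₂ ≤ 2) (h11 : n₃ ≤ 2) :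
    let bad : ℕ → ℕ := fun k =>
        (if c₁ then (if 1 ≤ nL then (tL).choose k else 0) + (if 2 ≤ nL then (5 - tL) * (tL).choose (k - 1) else 0) else (if 2 ≤ nL then (tL).choose k else 0)) +
        (if c₂ then (if 1 ≤ n₂ then (s₂).choose k else 0) + (if 2 ≤ n₂ then (5 - s₂) * (s₂).choose (k - 1) else 0) else (if 2 ≤ n₂ then (s₂).choose k else 0)) +
        (if c₃ then (if 1 ≤ n₃ then (s₃).choose k else 0) + (if 2 ≤ n₃ then (5 - s₃) * (s₃).choose (k - 1) else 0) else (if 2 ≤ n₃ then (s₃).choose k else 0));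
    139230 ≤ 69300 +
        13860 * (5 - (if 2 ≤ n₂ ∧ ¬ c₂ then s₂ else 0) - (if 2 ≤ n₃ ∧ ¬ c₃ then s₃ else 0)) +
        7560 * (Nat.choose 5 2 - bad 2) +
        3240 * (Nat.choose 5 3 - bad 3) +
        1620 * (Nat.choose 5 4 - bad 4) +
        900 * (Nat.choose 5 5 - bad 5) := by
  intro bad
  obtain ⟨h8a, h8b, h8c⟩ := h8
  obtain ⟨h9a, h9b, h9c⟩ := h9
  obtain rfl : nM = 4 - nL - nA := by omega
  obtain rfl : tM = 5 - tL - tA := by omega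
  rcases (show (nA = n₂ ∧ tA = s₂) ∨ (n₂ = nA + 1 ∧ tA = s₂) ∨ (nA = n₂ ∧ s₂ = tA + 1) by omega) with
    ⟨rfl, rfl⟩ | ⟨rfl, rfl⟩ | ⟨rfl, rfl⟩
  · -- `p₂ = 0`
    rcases (show (n₃ = 4 - nL - nA ∧ s₃ = 5 - tL - tA) ∨ (n₃ = 4 - nL - nA + 1 ∧ s₃ = 5 - tL - tA) ∨
        (n₃ = 4 - nL - nA ∧ s₃ = 5 - tL - tA + 1) by omega) with ⟨rfl, rfl⟩ | ⟨rfl, rfl⟩ | ⟨rfl, rfl⟩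
    · exact dd_arith_N6_p00 c₁ c₂ c₃ nL nA tL tA hc₁ h2 h3 h4 h5 h6 h7 h10 h11
    · exact dd_arith_N6_p01 c₁ c₂ c₃ nL nA tL tA hc₁ h2 h3 h4 h5 h6 h7 h10 h11
    · exact dd_arith_N6_p02 c₁ c₂ c₃ nL nA tL tA hc₁ h2 h3 h4 h5 h6 h7 h10 h11
  · -- `p₂ = 1`
    rcases (show (n₃ = 4 - nL - nA ∧ s₃ = 5 - tL - tA) ∨ (n₃ = 4 - nL - nA + 1 ∧ s₃ = 5 - tL - tA) ∨
        (n₃ = 4 - nL - nA ∧ s₃ = 5 - tL - tA + 1) by omega) with ⟨rfl, rfl⟩ | ⟨rfl, rfl⟩ | ⟨rfl, rfl⟩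
    · exact dd_arith_N6_p10 c₁ c₂ c₃ nL nA tL tA hc₁ h2 h3 h4 h5 h6 h7 h10 h11
    · exact dd_arith_N6_p11 c₁ c₂ c₃ nL nA tL tA hc₁ h2 h3 h4 h5 h6 h7 h10 h11
    · exact dd_arith_N6_p12 c₁ c₂ c₃ nL nA tL tA hc₁ h2 h3 h4 h5 h6 h7 h10 h11
  · -- `p₂ = 2`
    rcases (show (n₃ = 4 - nL - nA ∧ s₃ = 5 - tL - tA) ∨ (n₃ = 4 - nL - nA + 1 ∧ s₃ = 5 - tL - tA) ∨
        (n₃ = 4 - nL - nA ∧ s₃ = 5 - tL - tA + 1) by omega) with ⟨rfl, rfl⟩ | ⟨rfl, rfl⟩ | ⟨rfl, rfl⟩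
    · exact dd_arith_N6_p20 c₁ c₂ c₃ nL nA tL tA hc₁ h2 h3 h4 h5 h6 h7 h10 h11
    · exact dd_arith_N6_p21 c₁ c₂ c₃ nL nA tL tA hc₁ h2 h3 h4 h5 h6 h7 h10 h11
    · exact dd_arith_N6_p22 c₁ c₂ c₃ nL nA tL tA hc₁ h2 h3 h4 h5 h6 h7 h10 h11

/-- **The fair share of every lossy basis pair of the doubly degenerate regime at `N = 6`.** -/
theorem basis_pair_fair_fat_dd_six_all (hG : G ∈ flatsQ M (5 + 1)) (hd : (gr M \ G).card = 2)
    (hk : kColoops M G = 1) (hs : ∀ e ∈ gr M, ∀ f ∈ gr M, e ≠ f → rkN M {e, f} = 2)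
    (hl : ∀ e ∈ gr M, M.Indep {e}) (hfat : (fatClosures M 5 G 2).card ≤ 1) {B₀ : Finset α}
    (hB₀ : B₀ ∈ thinMembers M 5 G) {w₀ x : α} (hD : G \ clF M B₀ = {w₀, x}) (hne : w₀ ≠ x) {R₁ : Finset α}
    (hR₁V : R₁ ⊆ (G \ coloops M G) \ {w₀, x}) (hR₁2 : rkN M R₁ = 2) (hR₁3 : 3 ≤ R₁.card)
    (hcop : rkN M (insert w₀ (insert x R₁)) ≤ 3) {c₂ c₃ : α}
    (hc₂V : c₂ ∈ (G \ coloops M G) \ {w₀, x}) (hc₃V : c₃ ∈ (G \ coloops M G) \ {w₀, x})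
    (hc₂ : c₂ ∉ clF M R₁) (hc₃ : c₃ ∉ clF M (insert c₂ R₁))
    (hcover : ∀ e ∈ (G \ coloops M G) \ {w₀, x}, e ∈ clF M (insert c₂ R₁) ∨ e ∈ clF M (insert c₃ R₁))
    (hdeg₂ : rkN M (((G \ coloops M G) \ {w₀, x}).filter (fun e => e ∈ clF M (insert c₂ R₁) ∧ e ∉ clF M R₁)) ≤ 2)
    (hdeg₃ : rkN M (((G \ coloops M G) \ {w₀, x}).filter (fun e => e ∈ clF M (insert c₃ R₁) ∧ e ∉ clF M R₁)) ≤ 2)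
    {B : Finset α} (hB : B ∈ thinMembers M 5 G) (hnP : ¬ bigP M G B) {z : α} (hz : z ∈ G \ clF M B)
    (hl0 : loss M 5 G B z ≠ 0) (hw₀ : w₀ ∈ insert z B) (hx : x ∉ insert z B) (hN : (G \ insert z B).card = 6) :
    loss M 5 G B z ≤ rhoL M 5 G B z * lossIncomeH M 5 G (bigP M G) (dshGT2 M 5 G) B z := by
  have hf := dd_cell_facts hG hd hk hs hfat hB₀ hD hne hR₁V hR₁2 hR₁3 hcop hc₂V hc₃V hc₂ hc₃ hcover hdeg₂ hdeg₃
    hB hnP hz hw₀ hx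
  dsimp only at hf
  obtain ⟨h1, h2, h3, h4, h5, h6, h7, h8, h9⟩ := hf
  have hxGQ : x ∈ G \ insert z B := by
    have : x ∈ G \ clF M B₀ := by rw [hD]; exact Finset.mem_insert_of_mem (Finset.mem_singleton_self _)
    exact Finset.mem_sdiff.2 ⟨(Finset.mem_sdiff.1 this).1, hx⟩
  have hWm : ((G \ insert z B).erase x).card = 5 := by
    rw [Finset.card_erase_of_mem hxGQ, hN]
  rw [hWm] at h2
  have hPind : M.Indep ((((insert z B \ coloops M G).erase w₀) : Finset α) : Set α) := basis_points_indep hG hd hk hB hnP hz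
  have h10 : (((insert z B \ coloops M G).erase w₀).filter (fun e => e ∈ clF M (((G \ coloops M G) \ {w₀, x}).filter (fun e => e ∈ clF M (insert c₂ R₁) ∧ e ∉ clF M R₁)))).card ≤ 2 := (card_filter_clF_le_rkN_of_indep hPind).trans hdeg₂
  have h11 : (((insert z B \ coloops M G).erase w₀).filter (fun e => e ∈ clF M (((G \ coloops M G) \ {w₀, x}).filter (fun e => e ∈ clF M (insert c₃ R₁) ∧ e ∉ clF M R₁)))).card ≤ 2 := (card_filter_clF_le_rkN_of_indep hPind).trans hdeg₃
  have hnum := dd_arith_N6_all (rkN M (insert w₀ (insert x R₁)) ≤ 3) (rkN M (insert w₀ (insert x (((G \ coloops M G) \ {w₀, x}).filter (fun e => e ∈ clF M (insert c₂ R₁) ∧ e ∉ clF M R₁)))) ≤ 3) (rkN M (insert w₀ (insert x (((G \ coloops M G) \ {w₀, x}).filter (fun e => e ∈ clF M (insert c₃ R₁) ∧ e ∉ clF M R₁)))) ≤ 3)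
    (((insert z B \ coloops M G).erase w₀).filter (fun e => e ∈ clF M R₁)).card (((insert z B \ coloops M G).erase w₀).filter (fun e => e ∈ (((G \ coloops M G) \ {w₀, x}).filter (fun e => e ∈ clF M (insert c₂ R₁) ∧ e ∉ clF M R₁)))).card (((insert z B \ coloops M G).erase w₀).filter (fun e => e ∈ (((G \ coloops M G) \ {w₀, x}).filter (fun e => e ∈ clF M (insert c₃ R₁) ∧ e ∉ clF M R₁)))).card (((G \ insert z B).erase x).filter (fun e => e ∈ clF M R₁)).card (((G \ insert z B).erase x).filter (fun e => e ∈ (((G \ coloops M G) \ {w₀, x}).filter (fun e => e ∈ clF M (insert c₂ R₁) ∧ e ∉ clF M R₁)))).card (((G \ insert z B).erase x).filter (fun e => e ∈ (((G \ coloops M G) \ {w₀, x}).filter (fun e => e ∈ clF M (insert c₃ R₁) ∧ e ∉ clF M R₁)))).card (((insert z B \ coloops M G).erase w₀).filter (fun e => e ∈ clF M (((G \ coloops M G) \ {w₀, x}).filter (fun e => e ∈ clF M (insert c₂ R₁) ∧ e ∉ clF M R₁)))).card (((G \ insert z B).erase x).filter (fun e => e ∈ clF M (((G \ coloops M G) \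 {w₀, x}).filter (fun e => e ∈ clF M (insert c₂ R₁) ∧ e ∉ clF M R₁)))).card (((insert z B \ coloops M G).erase w₀).filter (fun e => e ∈ clF M (((G \ coloops M G) \ {w₀, x}).filter (fun e => e ∈ clF M (insert c₃ R₁) ∧ e ∉ clF M R₁)))).card (((G \ insert z B).erase x).filter (fun e => e ∈ clF M (((G \ coloops M G) \ {w₀, x}).filter (fun e => e ∈ clF M (insert c₃ R₁) ∧ e ∉ clF M R₁)))).card
    hcop h1 h2 h3 h4 h5 h6 h7 h8 h9 h10 h11
  exact basis_pair_fair_fat_dd_of_numeric_six hG hd hk hs hl hfat hB₀ hD hne hR₁V hR₁2 hR₁3 hcop hc₂V hc₃V hc₂ hc₃ hcover hdeg₂ hdeg₃ hB hnP hz hl0 hw₀ hx hN hnum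

/-- **The fair share of every lossy basis pair of the doubly degenerate regime.** -/
theorem basis_pair_fair_fat_dd (hG : G ∈ flatsQ M (5 + 1)) (hd : (gr M \ G).card = 2)
    (hk : kColoops M G = 1) (hs : ∀ e ∈ gr M, ∀ f ∈ gr M, e ≠ f → rkN M {e, f} = 2)
    (hl : ∀ e ∈ gr M, M.Indep {e}) (hfat : (fatClosures M 5 G 2).card ≤ 1) {B₀ : Finset α}
    (hB₀ : B₀ ∈ thinMembers M 5 G) {w₀ x : α} (hD : G \ clF M B₀ = {w₀, x}) (hne : w₀ ≠ x) {R₁ : Finset α}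
    (hR₁V : R₁ ⊆ (G \ coloops M G) \ {w₀, x}) (hR₁2 : rkN M R₁ = 2) (hR₁3 : 3 ≤ R₁.card)
    (hcop : rkN M (insert w₀ (insert x R₁)) ≤ 3) {c₂ c₃ : α}
    (hc₂V : c₂ ∈ (G \ coloops M G) \ {w₀, x}) (hc₃V : c₃ ∈ (G \ coloops M G) \ {w₀, x})
    (hc₂ : c₂ ∉ clF M R₁) (hc₃ : c₃ ∉ clF M (insert c₂ R₁))
    (hcover : ∀ e ∈ (G \ coloops M G) \ {w₀, x}, e ∈ clF M (insert c₂ R₁) ∨ e ∈ clF M (insert c₃ R₁))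
    (hdeg₂ : rkN M (((G \ coloops M G) \ {w₀, x}).filter (fun e => e ∈ clF M (insert c₂ R₁) ∧ e ∉ clF M R₁)) ≤ 2)
    (hdeg₃ : rkN M (((G \ coloops M G) \ {w₀, x}).filter (fun e => e ∈ clF M (insert c₃ R₁) ∧ e ∉ clF M R₁)) ≤ 2)
    {B : Finset α} (hB : B ∈ thinMembers M 5 G) (hnP : ¬ bigP M G B) {z : α} (hz : z ∈ G \ clF M B)
    (hl0 : loss M 5 G B z ≠ 0) (hw₀ : w₀ ∈ insert z B) (hx : x ∉ insert z B) :
    loss M 5 G B z ≤ rhoL M 5 G B z * lossIncomeH M 5 G (bigP M G) (dshGT2 M 5 G) B z := by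
  -- `N ≥ 6`: `V = P₀ ∪ W′` has `≥ 9` points
  have hN6 : 6 ≤ (G \ insert z B).card := by
    have hGg : G ⊆ gr M := (mem_flatsQ.1 hG).1
    set V := (G \ coloops M G) \ {w₀, x} with hV
    have hVg : V ⊆ gr M := fun e he => hGg (Finset.mem_sdiff.1 (Finset.mem_sdiff.1 he).1).1
    have hR₁g : R₁ ⊆ gr M := hR₁V.trans hVg
    have hc₂g : c₂ ∈ gr M := hVg hc₂V
    have hc₃g : c₃ ∈ gr M := hVg hc₃V
    have hc₃L : c₃ ∉ clF M R₁ := fun h => hc₃ (clF_mono (Finset.subset_insert _ _) h)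
    have hc₂' : c₂ ∉ clF M (insert c₃ R₁) := fun h =>
      hc₂ (mem_clF_of_mem_two_planes hR₁g hc₂g hc₃g hc₂ hc₃
        (subset_clF_of_subset_gr (Finset.insert_subset hc₂g hR₁g) (Finset.mem_insert_self _ _)) h)
    have hcover' : ∀ e ∈ V, e ∈ clF M (insert c₃ R₁) ∨ e ∈ clF M (insert c₂ R₁) := fun e he => (hcover e he).symm
    set Lset := V.filter (fun e => e ∈ clF M R₁) with hLset
    set Aset := V.filter (fun e => e ∈ clF M (insert c₂ R₁) ∧ e ∉ clF M R₁) with hAset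
    set Mset := V.filter (fun e => e ∈ clF M (insert c₃ R₁) ∧ e ∉ clF M R₁) with hMset
    have hL3 : 3 ≤ Lset.card := by
      have hsub : R₁ ⊆ Lset := fun e he => Finset.mem_filter.2 ⟨hR₁V he, subset_clF_of_subset_gr hR₁g he⟩
      exact hR₁3.trans (Finset.card_le_card hsub)
    have hA3 : 3 ≤ Aset.card := three_le_card_side_of_fat hG hd hk hs hfat hB₀ hD hne hR₁V hR₁2 hR₁3 hcop hc₃V
      hc₂V hc₃L hc₂' hcover'
    have hM3 : 3 ≤ Mset.card := three_le_card_side_of_fat hG hd hk hs hfat hB₀ hD hne hR₁V hR₁2 hR₁3 hcop hc₂V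
      hc₃V hc₂ hc₃ hcover
    have hunion : Lset ∪ (Aset ∪ Mset) ⊆ V :=
      Finset.union_subset (Finset.filter_subset _ _)
        (Finset.union_subset (Finset.filter_subset _ _) (Finset.filter_subset _ _))
    have hd1 : Disjoint Lset (Aset ∪ Mset) := by
      rw [Finset.disjoint_left]
      intro e he₁ he₂
      rw [Finset.mem_union] at he₂
      rcases he₂ with h | h
      · exact (Finset.mem_filter.1 h).2.2 (Finset.mem_filter.1 he₁).2
      · exact (Finset.mem_filter.1 h).2.2 (Finset.mem_filter.1 he₁).2
    have hd2 : Disjoint Aset Mset := by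
      rw [Finset.disjoint_left]
      intro e he₁ he₂
      exact (Finset.mem_filter.1 he₁).2.2 (mem_clF_of_mem_two_planes hR₁g hc₂g hc₃g hc₂ hc₃
        (Finset.mem_filter.1 he₁).2.1 (Finset.mem_filter.1 he₂).2.1)
    have h9 : 9 ≤ V.card := by
      have := Finset.card_le_card hunion
      rw [Finset.card_union_of_disjoint hd1, Finset.card_union_of_disjoint hd2] at this
      omega
    -- `V = P₀ ∪ W′`
    have hPV := basis_points_subset_V (w₀ := w₀) hB hz hx
    have hWV := W_subset_V (x := x) hG hd hB hw₀
    have hP4 := card_basis_points hG hd hk hB₀ hD hB hnP hz hw₀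
    have hcov : V ⊆ (insert z B \ coloops M G).erase w₀ ∪ (G \ insert z B).erase x := by
      intro e he
      rw [Finset.mem_union]
      exact mem_basis_or_W_of_mem_V he
    have h1 := Finset.card_le_card hcov
    have h2 := Finset.card_union_le ((insert z B \ coloops M G).erase w₀) ((G \ insert z B).erase x)
    have hxG : x ∈ G \ insert z B := by
      refine Finset.mem_sdiff.2 ⟨?_, hx⟩
      have : x ∈ G \ clF M B₀ := by
        rw [hD]
        exact Finset.mem_insert_of_mem (Finset.mem_singleton_self _)
      exact (Finset.mem_sdiff.1 this).1
    have h3 : ((G \ insert z B).erase x).card + 1 = (G \ insert z B).card := by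
      rw [Finset.card_erase_of_mem hxG]
      have : 0 < (G \ insert z B).card := Finset.card_pos.2 ⟨x, hxG⟩
      omega
    omega
  obtain h | h | h | h | h | h : (G \ insert z B).card = 6 ∨ (G \ insert z B).card = 7 ∨
      (G \ insert z B).card = 8 ∨ (G \ insert z B).card = 9 ∨ (G \ insert z B).card = 10 ∨
      11 ≤ (G \ insert z B).card := by omega
  · exact basis_pair_fair_fat_dd_six_all hG hd hk hs hl hfat hB₀ hD hne hR₁V hR₁2 hR₁3 hcop hc₂V hc₃V hc₂ hc₃ hcover
      hdeg₂ hdeg₃ hB hnP hz hl0 hw₀ hx h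
  · exact basis_pair_fair_fat_dd_seven hG hd hk hs hl hfat hB₀ hD hne hR₁V hR₁2 hR₁3 hcop hc₂V hc₃V hc₂ hc₃ hcover
      hdeg₂ hdeg₃ hB hnP hz hl0 hw₀ hx h
  · exact basis_pair_fair_fat_dd_eight hG hd hk hs hl hfat hB₀ hD hne hR₁V hR₁2 hR₁3 hcop hc₂V hc₃V hc₂ hc₃ hcover
      hdeg₂ hdeg₃ hB hnP hz hl0 hw₀ hx h
  · exact basis_pair_fair_fat_dd_nine hG hd hk hs hl hfat hB₀ hD hne hR₁V hR₁2 hR₁3 hcop hc₂V hc₃V hc₂ hc₃ hcover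
      hdeg₂ hdeg₃ hB hnP hz hl0 hw₀ hx h
  · exact basis_pair_fair_fat_dd_ten hG hd hk hs hl hfat hB₀ hD hne hR₁V hR₁2 hR₁3 hcop hc₂V hc₃V hc₂ hc₃ hcover
      hdeg₂ hdeg₃ hB hnP hz hl0 hw₀ hx h
  · exact basis_pair_fair_fat_dd_large hG hd hk hs hl hfat hB₀ hD hne hR₁V hR₁2 hR₁3 hcop hc₂V hc₃V hc₂ hc₃ hcover
      hdeg₂ hdeg₃ hB hnP hz hl0 hw₀ hx h

/-- **The local Hall inequality of the cell in the doubly degenerate two-planes regime.** -/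
theorem localShadowHall_fat_of_two_planes_doubly_deg (hG : G ∈ flatsQ M (5 + 1)) (hd : (gr M \ G).card = 2)
    (hk : kColoops M G = 1) (hs : ∀ e ∈ gr M, ∀ f ∈ gr M, e ≠ f → rkN M {e, f} = 2)
    (hl : ∀ e ∈ gr M, M.Indep {e}) (hfat : (fatClosures M 5 G 2).card ≤ 1)
    {B₀ : Finset α} (hB₀ : B₀ ∈ thinMembers M 5 G) {w₀ x : α} (hD : G \ clF M B₀ = {w₀, x}) (hne : w₀ ≠ x)
    {R₁ : Finset α}
    (hR₁V : R₁ ⊆ (G \ coloops M G) \ {w₀, x}) (hR₁2 : rkN M R₁ = 2) (hR₁3 : 3 ≤ R₁.card)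
    (hcop : rkN M (insert w₀ (insert x R₁)) ≤ 3) {c₂ c₃ : α}
    (hc₂V : c₂ ∈ (G \ coloops M G) \ {w₀, x}) (hc₃V : c₃ ∈ (G \ coloops M G) \ {w₀, x})
    (hc₂ : c₂ ∉ clF M R₁) (hc₃ : c₃ ∉ clF M (insert c₂ R₁))
    (hcover : ∀ e ∈ (G \ coloops M G) \ {w₀, x}, e ∈ clF M (insert c₂ R₁) ∨ e ∈ clF M (insert c₃ R₁))
    (hdeg₂ : rkN M (((G \ coloops M G) \ {w₀, x}).filter (fun e => e ∈ clF M (insert c₂ R₁) ∧ e ∉ clF M R₁)) ≤ 2)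
    (hdeg₃ : rkN M (((G \ coloops M G) \ {w₀, x}).filter (fun e => e ∈ clF M (insert c₃ R₁) ∧ e ∉ clF M R₁)) ≤ 2) :
    LocalShadowHall M 5 G := by
  apply localShadowHall_of_gt2_of_basis_fair hG hd hk hs hl hfat
  intro B hB hnP z hz
  have hd' : (gr M \ G).card ≤ 5 := by omega
  by_cases hl0 : loss M 5 G B z = 0
  · rw [hl0]
    have h1 : 0 ≤ rhoL M 5 G B z := by
      unfold rhoL
      rw [hl0]
      simp
    have h2 : 0 ≤ lossIncomeH M 5 G (bigP M G) (dshGT2 M 5 G) B z :=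
      lossIncomeH_nonneg hG hd' (column_side_gt2 hG hd hk hs hl hfat) B z
    positivity
  · have hm₀ : (G \ clF M B₀).card = 2 := by rw [hD, Finset.card_pair hne]
    obtain ⟨u, v, hD', hne', hu, hv⟩ := exists_fat_split hG hd hk hB₀ hm₀ hB hz hl0
    have hpair : ({u, v} : Finset α) = {w₀, x} := by rw [← hD', hD]
    have hR₁V' : R₁ ⊆ (G \ coloops M G) \ {u, v} := by rw [hpair]; exact hR₁V
    have hc₂V' : c₂ ∈ (G \ coloops M G) \ {u, v} := by rw [hpair]; exact hc₂V
    have hc₃V' : c₃ ∈ (G \ coloops M G) \ {u, v} := by rw [hpair]; exact hc₃V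
    have hcover' : ∀ e ∈ (G \ coloops M G) \ {u, v}, e ∈ clF M (insert c₂ R₁) ∨ e ∈ clF M (insert c₃ R₁) := by
      rw [hpair]; exact hcover
    have hdeg₂' : rkN M (((G \ coloops M G) \ {u, v}).filter
        (fun e => e ∈ clF M (insert c₂ R₁) ∧ e ∉ clF M R₁)) ≤ 2 := by rw [hpair]; exact hdeg₂
    have hdeg₃' : rkN M (((G \ coloops M G) \ {u, v}).filter
        (fun e => e ∈ clF M (insert c₃ R₁) ∧ e ∉ clF M R₁)) ≤ 2 := by rw [hpair]; exact hdeg₃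
    have hcop' : rkN M (insert u (insert v R₁)) ≤ 3 := by
      have heq : insert u (insert v R₁) = insert w₀ (insert x R₁) := by
        have h1 : insert u (insert v R₁) = ({u, v} : Finset α) ∪ R₁ := by
          ext e
          simp only [Finset.mem_insert, Finset.mem_union, Finset.mem_singleton]
          tauto
        have h2 : insert w₀ (insert x R₁) = ({w₀, x} : Finset α) ∪ R₁ := by
          ext e
          simp only [Finset.mem_insert, Finset.mem_union, Finset.mem_singleton]
          tauto
        rw [h1, h2, hpair]
      rw [heq]
      exact hcop
    exact basis_pair_fair_fat_dd hG hd hk hs hl hfat hB₀ hD' hne' hR₁V' hR₁2 hR₁3 hcop' hc₂V' hc₃V' hc₂ hc₃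
      hcover' hdeg₂' hdeg₃' hB hnP hz hl0 hu hv

/-- **THE FAT CASE OF (FAIR), UNCONDITIONAL**: the local Hall inequality of a cell `(2, 1)` with a fat closure
(`|G ∖ clF B₀| = 2`) — every lossy big pair has a good point, or `H₀` is two planes through a class line and the
planes are both non-degenerate (gen 34), exactly one degenerate (gen 35) or both degenerate (gen 36). -/
theorem localShadowHall_fat (hG : G ∈ flatsQ M (5 + 1)) (hd : (gr M \ G).card = 2)
    (hk : kColoops M G = 1) (hs : ∀ e ∈ gr M, ∀ f ∈ gr M, e ≠ f → rkN M {e, f} = 2)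
    (hl : ∀ e ∈ gr M, M.Indep {e}) (hfat : (fatClosures M 5 G 2).card ≤ 1)
    {B₀ : Finset α} (hB₀ : B₀ ∈ thinMembers M 5 G) (hm₀ : (G \ clF M B₀).card = 2) :
    LocalShadowHall M 5 G := by
  by_cases hgood : ∀ B ∈ thinMembers M 5 G, 5 ≤ (B \ coloops M G).card → ∀ z ∈ G \ clF M B,
      loss M 5 G B z ≠ 0 → (gtPts M 5 G (insert z B)).Nonempty
  · exact localShadowHall_fat_of_good hG hd hk hs hl hfat hB₀ hm₀ hgood
  · obtain ⟨B, hB, hbig, z, hz, hloss, hno⟩ : ∃ B ∈ thinMembers M 5 G, 5 ≤ (B \ coloops M G).card ∧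
        ∃ z ∈ G \ clF M B, loss M 5 G B z ≠ 0 ∧ ¬ (gtPts M 5 G (insert z B)).Nonempty := by
      by_contra hcon
      apply hgood
      intro B hB hbig z hz hloss
      by_contra hno
      exact hcon ⟨B, hB, hbig, z, hz, hloss, hno⟩
    obtain ⟨w₀, x, hne, hD⟩ := Finset.card_eq_two.1 hm₀
    obtain ⟨R₁, hR₁Q, hR₁2, hR₁3, -, hcop, c₂, hc₂Q, c₃, hc₃Q, hc₂, hc₃, hcover⟩ :=
      exists_two_planes_of_no_gtPts hG hd hk hs hl hB₀ hD hB hbig hz hloss hno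
    have hGg : G ⊆ gr M := (mem_flatsQ.1 hG).1
    have hQG : insert z B ⊆ G :=
      Finset.insert_subset (Finset.mem_sdiff.1 hz).1 (subset_G_of_mem_thinMembers hB)
    have hQV : (insert z B \ coloops M G) \ {w₀, x} ⊆ (G \ coloops M G) \ {w₀, x} :=
      Finset.sdiff_subset_sdiff (Finset.sdiff_subset_sdiff hQG (Finset.Subset.refl _)) (Finset.Subset.refl _)
    have hR₁V : R₁ ⊆ (G \ coloops M G) \ {w₀, x} := hR₁Q.trans hQV
    have hc₂V : c₂ ∈ (G \ coloops M G) \ {w₀, x} := hQV hc₂Q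
    have hc₃V : c₃ ∈ (G \ coloops M G) \ {w₀, x} := hQV hc₃Q
    have hVg : (G \ coloops M G) \ {w₀, x} ⊆ gr M := fun e he =>
      hGg (Finset.mem_sdiff.1 (Finset.mem_sdiff.1 he).1).1
    have hR₁g : R₁ ⊆ gr M := hR₁V.trans hVg
    have hc₂g : c₂ ∈ gr M := hVg hc₂V
    have hc₃g : c₃ ∈ gr M := hVg hc₃V
    have hc₃L : c₃ ∉ clF M R₁ := fun h' => hc₃ (clF_mono (Finset.subset_insert _ _) h')
    have hc₂π₃ : c₂ ∉ clF M (insert c₃ R₁) := notMem_clF_insert_of_notMem_clF_insert hR₁g hc₂g hc₃g hc₂ hc₃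
    by_cases hnd₂ : 3 ≤ rkN M (((G \ coloops M G) \ {w₀, x}).filter
        (fun e => e ∈ clF M (insert c₂ R₁) ∧ e ∉ clF M R₁))
    · by_cases hnd₃ : 3 ≤ rkN M (((G \ coloops M G) \ {w₀, x}).filter
          (fun e => e ∈ clF M (insert c₃ R₁) ∧ e ∉ clF M R₁))
      · exact localShadowHall_fat_of_two_planes_nondeg hG hd hk hs hl hfat hB₀ hD hne hR₁V hR₁2 hR₁3 hc₂V hc₃V hc₂
          hc₃ hcover hnd₂ hnd₃
      · exact localShadowHall_fat_of_two_planes_singly_deg hG hd hk hs hl hfat hB₀ hD hne hR₁V hR₁2 hR₁3 hcop hc₂V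
          hc₃V hc₂ hc₃ hcover hnd₂ (by omega)
    · by_cases hnd₃ : 3 ≤ rkN M (((G \ coloops M G) \ {w₀, x}).filter
          (fun e => e ∈ clF M (insert c₃ R₁) ∧ e ∉ clF M R₁))
      · -- `π₂` degenerate, `π₃` not: swap the roles of the planes
        exact localShadowHall_fat_of_two_planes_singly_deg hG hd hk hs hl hfat hB₀ hD hne hR₁V hR₁2 hR₁3 hcop hc₃V
          hc₂V hc₃L hc₂π₃ (fun e he => (hcover e he).symm) hnd₃ (by omega)
      · exact localShadowHall_fat_of_two_planes_doubly_deg hG hd hk hs hl hfat hB₀ hD hne hR₁V hR₁2 hR₁3 hcop hc₂V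
          hc₃V hc₂ hc₃ hcover (by omega) (by omega)

end PercRepro.Shadow
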